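import Summits.HodgeConjecture.HodgeConjecture.Theorems.K2E1bArchPacketSignsOfParts   -- ★ Q11 p856747: `UnitaryDualWith` (+ `K2E1bArchPacketSignsDefs`: `IsRegularParam`, `casimirOf`, `centralOf`)
import Summits.HodgeConjecture.HodgeConjecture.Theorems.K2E1bDSRecordRecognition     -- ★ 8b-γ p856936 (K2E4-p10 (g2)): `exists_mk_ofRecord_eq_cls` (+ ★ Q9c record table, ★ #23 `ρKOfRecord`∕`σOfRecord`)
import Summits.HodgeConjecture.HodgeConjecture.Theorems.K2E1bCubicCasimirCentral      -- ★ U8-4c-A p856845 (K2-defs1 (g3)): `hasCubicPin_mk_iff` (+ ★ D-U8-1 `HasCubicScalar`, `SameCubicPin`)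
import HarnessLib

/-!
# K2 ∕ E1b unit U8d — GLUE ★ «socket 8b from its parts» (`UnitaryDualWith dsCarriersOfRecord P` from 8b-α ∕ 8b-β ∕ 8b-δ over ★ 8b-γ)

Cell hodgecm-mathlib, Track B «K2-LIT», engine E1b, unit U8d «Clozel–Delorme pseudo-coefficients with χ-support» (LEVEL B′, K2-lead R17);
crux item h413 = stmt-HodgeConjecture-24833 (supports-only helper; closes nothing by itself).  Author K2E1b-plan (g3), 2026-09-04.
TABLE `Cruxes/H413/Lines/K2_E1b_GKCohomologyU21_U8_ArchPacketSigns.md` ED. 8 §2d «8b = 8b-α ∕ 8b-β ∕ 8b-γ»; K2E1b-r01 (g4) interface analysis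
(bus 03:03:42Z): 8b-γ ★ `exists_mk_ofRecord_eq_cls` IS the 8b conclusion for an `x` PRESENTED as a structure of record at `e = centralOf a b c`, so
the remaining bricks must deliver (α) the presentation and (β) the `K`-types + products — plus (δ) the descent of unitarity to the datum.

THE FOUR NAMED INPUTS (each a `def … : Prop` with body here — DEFS BEFORE SIGS — to be PAID by a ★ theorem of exactly that type):
* `ModelOfRecordStmt` (8b-α, XL; the direction ABSENT from the tree — the Kraljević–Kovačević structure theorem): every admissible irreducible
  `(𝔤, K)`-module `r` of `U(2,1)` with χ-scalars `(κ, e)` is, up to `(𝔤, K)`-equivalence, the STRUCTURE OF RECORD `(ρKOfRecord 𝒟 e,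
  σOfRecord 𝒟 e)` (★ #23) of a Kovačević datum `𝒟` at the central weight `e` (Kovacevic2021 §3 Def. 1, Thm. 1–2 — `K`-types of multiplicity
  one, the weight bases `u^k_{n,m}`, relations (b20)–(b45); Kraljevic1973 — multiplicity one for `SU(n,1)`; BorelWallach2000 0 §2.5).
* `RecordIrreducibleStmt` (8b-α′, M): a datum whose record at `e` is an irreducible `(𝔤, K)`-module is irreducible as a `𝔤𝔩₃`-Lie module
  (a `𝔤𝔩₃`-submodule is a sum of weight spaces, the `𝔨`-Casimir separates `n`, so it is a sum of whole `K`-types, hence `K`-stable;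
  Kovacevic2021 §3 Thm. 1, BorelWallach2000 0 §2.5).
* `DatumUnitaryDualStmt` (8b-β, L): at a regular parameter, an irreducible UNITARIZABLE datum whose record at `e = centralOf a b c` has
  χ-scalars `(casimirOf a b c, centralOf a b c)` and the cubic scalar of the record cell `j` has the `K`-types and the invariant products of
  SOME record cell `i` (Rogawski1990 §12.2 p. 175, §12.3 pp. 176–178 — the six irreducibles `F_φ, J^±, D, D^±` at `χ_φ`, only the three
  `D`'s unitary at regular highest weight; Kovacevic2021 §3 Thm. 3, §4 Thm. 4; BorelWallach2000 VI 4.12; Molev2007 §7.1 — `Z(𝔤𝔩₃)` is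
  generated in degrees 1, 2, 3).  Consumes ★ U8-5 `K2E1bJStripNonUnitarizable` and the cubic calibration U8-4c (iii).
* `UnitarityDescendsStmt` (8b-δ, M): if a coh-unitary `r` (★ `IsCohUnitaryIrrep`: unitary along `𝔭 ⊕ ℝz₀`) is `(𝔤, K)`-equivalent to the
  record of `𝒟` at `e`, then `𝒟` is unitarizable in Kovačević's sense (★ `SU21Datum.IsUnitarizable`; BorelWallach2000 VI Thm. 4.12 (2),
  Kovacevic2021 §4 Thm. 4).  Road: ★ `isInfUnitary_of_isInfUnitaryAlongP` (upgrade to a `𝔤`-invariant Hermitian form), transport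
  along the `GKEquiv`, then the converse of ★ `hasInvariantHermitianForm_kovLie_of_isUnitarizable` (the twist scalar is purely imaginary,
  ★ `conj_twistScalar`).

THE GLUE (kernel-checked here, 0 sorry): `unitaryDualWith_of_parts P hP hα hα' hβ hδ : UnitaryDualWith dsCarriersOfRecord P` for EVERY support
predicate `P` implying the LEVEL-B′ pins `IsChiPinnedCohUnitary x (casimirOf a b c) (centralOf a b c) ∧ SameCubicPin x (dsClsOfRecord a b c j)`
(the unit's `levelBPin` is such a `P` with `hP := fun _ _ _ _ _ h => h`; the glue is stated for a general `P` because `levelBPin` lives in the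
`Lines` module).  Proof: unpack the pins to a representative `r` (coh-unitary, χ-scalars) and a common cubic scalar `s`; 8b-α presents `r` as a
record `r' = ⟨𝒟.V, ρKOfRecord 𝒟 e, σOfRecord 𝒟 e, _, _⟩` (8b-α′: the datum is then irreducible); the `GKEquiv` (★ `GKIrrClass.mk_eq_mk_iff`)
transports the χ-scalars (§0 `HasChiScalars.of_conj`, this file) and the cubic scalar (★ `hasCubicPin_mk_iff`); 8b-δ gives `IsUnitarizable 𝒟`;
8b-β gives the `K`-types and products of a record cell `i`; ★ 8b-γ `exists_mk_ofRecord_eq_cls` (with ★ `forall_reach_of_isIrreducible`) gives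
the class equality.  Then U8d ED. 3 pays `sig_K2E1bUnitaryDualAtRegularChi := unitaryDualWith_of_parts levelBPin (fun _ _ _ _ _ h => h) ‹α› ‹α′›
‹β› ‹δ›`.

HONEST LABEL: HC_CM is proved only modulo the 7 printed citations (2 remaining named inputs: hLiu418 = stmt-HodgeConjecture-24832, h413 =
stmt-HodgeConjecture-24833) until rung 0 closes; this file closes nothing — it moves socket 8b onto four typed bricks (α new direction XL,
α′ M, β L, δ M) over ★ 8b-γ.
-/

set_option autoImplicit false
set_option linter.dupNamespace false

noncomputable section

open Literature.NumberTheory.Automorphic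
open Literature.RepresentationTheory
open Literature.RepresentationTheory.BorelWallach2000
open Literature.RepresentationTheory.KonnoKonno2007 Literature.RepresentationTheory.KonnoKonno2007.RealDualPair
open Literature.RepresentationTheory.Kovacevic2021 Literature.RepresentationTheory.Kovacevic2021.SU21Datum
open Summit.HodgeConjecture.HodgeConjecture.Cruxes.H413.F0P3bLocalAPacketsDefs
open Summit.HodgeConjecture.HodgeConjecture.Cruxes.H413.F0P3bArchDegOnePackage (IsCohUnitaryIrrep)
open Summit.HodgeConjecture.HodgeConjecture.Cruxes.H413.K2E1bCarriersOfRecord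
open Summit.HodgeConjecture.HodgeConjecture.Cruxes.H413.K2E1bDSCellData
open Summit.HodgeConjecture.HodgeConjecture.Cruxes.H413.K2E1bDSClsOfRecord
open Summit.HodgeConjecture.HodgeConjecture.Cruxes.H413.K2E1bDSRecordRecognition

namespace Summit.HodgeConjecture.HodgeConjecture.Cruxes.H413.K2E1bGKCohomologyU21

-- Mathlib idiom (as in ★ `K2E1bDSRecordRecognition`, ★ `K2E1bDSClsOfRecord`): `Module.End ℂ V` ∕ matrices as Lie rings by commutators.
attribute [local instance 100] LieRing.ofAssociativeRing

/-! ## §0 χ-scalars are transported by an intertwining linear equivalence (hence are class invariants) -/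

/-- **χ-scalars are transported along a `𝔤`-intertwining linear equivalence**: the trace-form Casimir `upqCasimirOp` is a polynomial in the
`ρ𝔤(Y)` (★ `GKCasimir.op_apply`), and the centre `i·1 ∈ 𝔤` is one of the `Y`. [cite: BorelWallach2000, II §1.3] [cite: KnappVogan1995, Prop. 4.120] -/
theorem HasChiScalars.of_conj {V W : Type} [AddCommGroup V] [Module ℂ V] [AddCommGroup W] [Module ℂ W]
    {ρ𝔤 : (uFormGroup (Fin 2) (Fin 1)).lie →ₗ⁅ℝ⁆ Module.End ℂ V} {σ𝔤 : (uFormGroup (Fin 2) (Fin 1)).lie →ₗ⁅ℝ⁆ Module.End ℂ W} {κ e : ℤ}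
    (h : HasChiScalars ρ𝔤 κ e) (f : V ≃ₗ[ℂ] W) (hf : ∀ (X : (uFormGroup (Fin 2) (Fin 1)).lie) (v : V), f (ρ𝔤 X v) = σ𝔤 X (f v)) :
    HasChiScalars σ𝔤 κ e := by
  obtain ⟨hC, hZ⟩ := h
  refine ⟨fun w => ?_, fun Z hZI w => ?_⟩
  · obtain ⟨v, rfl⟩ := f.surjective w
    have hf' : f (upqCasimirOp ρ𝔤 v) = upqCasimirOp σ𝔤 (f v) := by
      simp only [upqCasimirOp, GKCasimir.op_apply, map_sum, hf]
    rw [← hf', hC v, map_smul]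
  · obtain ⟨v, rfl⟩ := f.surjective w
    rw [← hf, hZ Z hZI v, map_smul]

/-- **χ-pins are class invariants**: if `GKIrrClass.mk r = GKIrrClass.mk r'` then the χ-scalars of `r` are those of `r'` (★ `GKIrrClass.mk_eq_mk_iff`
+ §0). [cite: BorelWallach2000, I §4.3] [cite: KnappVogan1995, Prop. 4.120] -/
theorem HasChiScalars.of_mk_eq_mk {r r' : GKIrrep (uFormGroup (Fin 2) (Fin 1))} {κ e : ℤ} (h : HasChiScalars r.ρ𝔤 κ e)
    (hmk : GKIrrClass.mk r = GKIrrClass.mk r') : HasChiScalars r'.ρ𝔤 κ e := by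
  obtain ⟨E⟩ := (GKIrrClass.mk_eq_mk_iff r r').1 hmk
  exact h.of_conj E.toLinearEquiv E.map_ρ𝔤

namespace U8

/-! ## §1 The four named inputs of socket 8b (DEFS BEFORE SIGS — `def`s with bodies; each is PAID by a ★ theorem of exactly this type) -/

/-- **8b-α «MODEL OF RECORD» (XL; abstract → datum, the direction absent from the tree — the Kraljević–Kovačević structure theorem)**: every
admissible irreducible `(𝔤, K)`-module of `U(2,1)` with χ-scalars `(κ, e)` is `(𝔤, K)`-equivalent to the structure of record (★ #23
`ρKOfRecord`, `σOfRecord`) of a Kovačević datum at the central weight `e` (`K`-types of multiplicity one; weight bases `u^k_{n,m}` adapted to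
`𝔭 ⊗ V_{n,m} = V_{n±1,m±3}`; the relations (b20)–(b45) hold in any such basis; integrality of `(n, m, e)` from the genuine `K`-action).
(print: Kovacevic2021, §3 Def. 1, Thm. 1–2; BorelWallach2000, 0 §2.5) -/
def ModelOfRecordStmt : Prop :=
  ∀ (r : GKIrrep G21) (κ e : ℤ), IsAdmissibleGK r.ρK → HasChiScalars r.ρ𝔤 κ e →
    ∃ (𝒟 : SU21Datum) (hGK : IsGKModule G21 (ρKOfRecord 𝒟 e) (σOfRecord 𝒟 e))
      (hirr : IsIrreducibleGK (ρKOfRecord 𝒟 e) (σOfRecord 𝒟 e)),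
      GKIrrClass.mk r = GKIrrClass.mk ⟨𝒟.V, ρKOfRecord 𝒟 e, σOfRecord 𝒟 e, hGK, hirr⟩

/-- **8b-α′ «AN IRREDUCIBLE RECORD HAS AN IRREDUCIBLE DATUM» (M)**: if the structure of record of `𝒟` at `e` is an irreducible `(𝔤, K)`-module
then `𝒟.V` is an irreducible `𝔤𝔩₃(ℂ)`-Lie module (a `𝔤𝔩₃`-submodule is a sum of `(H_α, H_β)`-weight spaces and is stable under the
`𝔨`-Casimir, hence a sum of whole `K`-types `V_{n,m}`, hence stable under ★ `kTypeRepTw`; ★ `IsIrreducibleGK.nontrivial`).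
(print: Kovacevic2021, §3 Thm. 1; KnappVogan1995, §II.4 after Cor. 2.78) -/
def RecordIrreducibleStmt : Prop :=
  ∀ (𝒟 : SU21Datum) (e : ℤ), IsGKModule G21 (ρKOfRecord 𝒟 e) (σOfRecord 𝒟 e) →
    IsIrreducibleGK (ρKOfRecord 𝒟 e) (σOfRecord 𝒟 e) → LieModule.IsIrreducible ℂ (Matrix (Fin 3) (Fin 3) ℂ) 𝒟.V

/-- **8b-β «DATUM-LEVEL UNITARY DUAL AT A REGULAR INFINITESIMAL CHARACTER» (L)**: at `IsRegularParam a b c`, an irreducible unitarizable datum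
whose record at `e = centralOf a b c` has χ-scalars `(casimirOf a b c, centralOf a b c)` and whose cubic scalar is the cubic pin of the record
cell `j` has the `K`-types and the invariant products `A·D`, `B·C` of some record cell `i` (the six irreducibles at `χ_φ` are `F_φ, J^±_φ,
D_φ, D^±_φ`; only the three `D`'s are unitary at regular highest weight).
(print: Rogawski1990, §12.2 p. 175, §12.3 pp. 176–178; Kovacevic2021, §3 Thm. 3, §4 Thm. 4; BorelWallach2000, VI Thm. 4.12; Molev2007, §7.1) -/
def DatumUnitaryDualStmt : Prop :=
  ∀ (a b c : ℤ), IsRegularParam a b c → ∀ (j : Fin 3) (𝒟 : SU21Datum),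
    LieModule.IsIrreducible ℂ (Matrix (Fin 3) (Fin 3) ℂ) 𝒟.V → IsUnitarizable 𝒟 →
    HasChiScalars (σOfRecord 𝒟 (centralOf a b c)) (casimirOf a b c) (centralOf a b c) →
    (∃ s : ℂ, HasCubicScalar (σOfRecord 𝒟 (centralOf a b c)) s ∧ HasCubicPin (dsClsOfRecord a b c j) s) →
    ∃ i : Fin 3, 𝒟.S = (dsCellDatum i a b c).S ∧
      (∀ n m : ℤ, 𝒟.A n m * 𝒟.D (n + 1) (m + 3) = (dsCellDatum i a b c).A n m * (dsCellDatum i a b c).D (n + 1) (m + 3)) ∧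
      (∀ n m : ℤ, 𝒟.B n m * 𝒟.C (n + 1) (m - 3) = (dsCellDatum i a b c).B n m * (dsCellDatum i a b c).C (n + 1) (m - 3))

/-- **8b-δ «UNITARITY DESCENDS TO THE DATUM» (M)**: a coh-unitary `(𝔤, K)`-module (`IsCohUnitaryIrrep`: unitary along `𝔭 ⊕ ℝz₀`) that is
`(𝔤, K)`-equivalent to the record of a datum `𝒟` at `e` makes `𝒟` unitarizable (Kovačević's signed Hermitian form).
(print: BorelWallach2000, VI Thm. 4.12 (2); Kovacevic2021, §4 Thm. 4) -/
def UnitarityDescendsStmt : Prop :=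
  ∀ (r : GKIrrep G21) (𝒟 : SU21Datum) (e : ℤ)
    (hGK : IsGKModule G21 (ρKOfRecord 𝒟 e) (σOfRecord 𝒟 e)) (hirr : IsIrreducibleGK (ρKOfRecord 𝒟 e) (σOfRecord 𝒟 e)),
    IsCohUnitaryIrrep r.ρK r.ρ𝔤 → GKIrrClass.mk r = GKIrrClass.mk ⟨𝒟.V, ρKOfRecord 𝒟 e, σOfRecord 𝒟 e, hGK, hirr⟩ → IsUnitarizable 𝒟

/-! ## §2 The glue: socket 8b from its parts -/

/-- **SOCKET 8b FROM ITS PARTS** (kernel-checked composition; the LEVEL-B′ assembly of `UnitaryDualWith`): for every support predicate `P` implying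
the LEVEL-B′ pins, 8b-α ∕ 8b-α′ ∕ 8b-β ∕ 8b-δ and ★ 8b-γ `exists_mk_ofRecord_eq_cls` give `UnitaryDualWith dsCarriersOfRecord P`.
[cite: Rogawski1990, §12.3 pp. 176–178] [cite: Kovacevic2021, §3 Thm. 3; §4 Thm. 4] -/
theorem unitaryDualWith_of_parts (P : ℤ → ℤ → ℤ → Fin 3 → GKIrrClass (uFormGroup (Fin 2) (Fin 1)) → Prop)
    (hP : ∀ (a b c : ℤ) (j : Fin 3) (x : GKIrrClass (uFormGroup (Fin 2) (Fin 1))), P a b c j x →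
      IsChiPinnedCohUnitary x (casimirOf a b c) (centralOf a b c) ∧ SameCubicPin x (dsClsOfRecord a b c j))
    (hα : ModelOfRecordStmt) (hα' : RecordIrreducibleStmt) (hβ : DatumUnitaryDualStmt) (hδ : UnitarityDescendsStmt) :
    UnitaryDualWith dsCarriersOfRecord P := by
  intro a b c habc j x hx
  obtain ⟨⟨r, hrx, hcoh, hchi⟩, ⟨s, hxs, hjs⟩⟩ := hP a b c j x hx
  obtain ⟨𝒟, hGK, hirr, hmk⟩ := hα r (casimirOf a b c) (centralOf a b c) hcoh.adm hchi
  have hdirr : LieModule.IsIrreducible ℂ (Matrix (Fin 3) (Fin 3) ℂ) 𝒟.V := hα' 𝒟 (centralOf a b c) hGK hirr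
  have hchi' : HasChiScalars (σOfRecord 𝒟 (centralOf a b c)) (casimirOf a b c) (centralOf a b c) := hchi.of_mk_eq_mk hmk
  have hunit : IsUnitarizable 𝒟 := hδ r 𝒟 (centralOf a b c) hGK hirr hcoh hmk
  have hpin : HasCubicPin (GKIrrClass.mk (⟨𝒟.V, ρKOfRecord 𝒟 (centralOf a b c), σOfRecord 𝒟 (centralOf a b c), hGK, hirr⟩ :
      GKIrrep G21)) s := by
    rw [← hmk, hrx]; exact hxs
  have hcub : HasCubicScalar (σOfRecord 𝒟 (centralOf a b c)) s := (hasCubicPin_mk_iff _ s).1 hpin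
  haveI := hdirr
  obtain ⟨i, hS, hPr, hQr⟩ := hβ a b c habc j 𝒟 hdirr hunit hchi' ⟨s, hcub, hjs⟩
  obtain ⟨i', hi'⟩ := exists_mk_ofRecord_eq_cls habc i forall_reach_of_isIrreducible hS hPr hQr hGK hirr
  exact ⟨i', by rw [← hrx, hmk]; exact hi'⟩

/-- Monotonicity restated for the dealer: the glue for `P` gives the glue for every STRONGER support predicate `Q ≤ P` (★ `UnitaryDualWith.anti`).
[cite: Rogawski1990, §12.3 pp. 176–178] -/
theorem unitaryDualWith_of_parts_of_le (P Q : ℤ → ℤ → ℤ → Fin 3 → GKIrrClass (uFormGroup (Fin 2) (Fin 1)) → Prop)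
    (hQP : ∀ a b c j x, Q a b c j x → P a b c j x)
    (hP : ∀ (a b c : ℤ) (j : Fin 3) (x : GKIrrClass (uFormGroup (Fin 2) (Fin 1))), P a b c j x →
      IsChiPinnedCohUnitary x (casimirOf a b c) (centralOf a b c) ∧ SameCubicPin x (dsClsOfRecord a b c j))
    (hα : ModelOfRecordStmt) (hα' : RecordIrreducibleStmt) (hβ : DatumUnitaryDualStmt) (hδ : UnitarityDescendsStmt) :
    UnitaryDualWith dsCarriersOfRecord Q :=
  fun a b c habc j x hx => unitaryDualWith_of_parts P hP hα hα' hβ hδ a b c habc j x (hQP a b c j x hx)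

end U8

end Summit.HodgeConjecture.HodgeConjecture.Cruxes.H413.K2E1bGKCohomologyU21

end
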